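import Summits.BirchSwinnertonDyer.Rank1Residual.Additive.SignedTwistMinusLineShape
import Literature.NumberTheory.GaloisRepresentations.LocalFieldPadicProofs
import Literature.NumberTheory.GaloisRepresentations.LocalGlobalCohomologyFiniteProofs
import Literature.NumberTheory.GaloisRepresentations.TateDualityCounting
import Literature.NumberTheory.EllipticCurves.GaloisActionProofs
import HarnessLib

/-!
# B3 in level-`m` shape for the signed twist: the finiteness of `H¹(ℚ_p, W[p^m])` and its exponent
# `p^m` DISCHARGED (cell `b2b-bsdres`, CLASS-CLOSURE lane, class O10 — x1b GEN 40, class lead;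
# file 95 of the series)

HONEST FRAMING (cell `b2b-bsdres`, run/shared/lean/b2b/bsd-rank1-residual/, verbatim in every
file): the goal of the cell is to DELETE the COMBINATION-SHAPED residual classes of the
Birch–Swinnerton-Dyer formula for ALL analytic-rank `≤ 1` elliptic curves over `ℚ` — "full BSD
formula for every rank `≤ 1` curve in class `C`" assembled STRICTLY from published theorems — so
that the rank-`≤ 1` remainder becomes exactly the CONSTRUCTION-SHAPED classes, which are TYPED
(missing-input `Prop`s), NOT attempted. This is not "finishing BSD". CLASS-CLOSURE lane: prove
what is provable now; shrink each hard class to its core with data; no claim beyond stated classes;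
research routes on CONSTRUCTION-SHAPED X12 / O10; census / instrument output = EVIDENCE / conjecture
items, NEVER a Literature fact; `RESIDUAL-MAP.md` marks change only by signed lines. THIS FILE:
TOOL THEOREMS ONLY — no definition, no named Literature fact, no `sorry`, axioms standard; nothing
is booked; no label / mark / count / sub-cell moves; (C1_η), (C2_η-GZ), (C3_η) stay typed as filed
(cc-typer-6's pen); nothing about `BSD(W, p)` of any pair is claimed.

## What

Two of the four inputs of file 94 (`SignedTwist.closure_minus_sup_eq_top_and_card_eq`) are
theorems of the tree at the model `ℚ_[p]`:

* `finite_galoisCohomology_torsion_padic`: **`H¹(ℚ_p, W[n])` is finite** (`n ≠ 0`) — the tree's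
  `finite_galoisCohomology_one_of_isNonarchimedeanLocalField` (Serre, *Cohomologie galoisienne*
  II §5.2 Prop. 14) with the DISCHARGED local-field structure of `ℚ_[p]`
  (`Padic.isNonarchimedeanLocalField_holds`) and the finiteness of `E[n]` (`finite_torsionPoints_holds`).
* `pow_smul_galoisCohomology_torsion_eq_zero`: **`p^m` kills `H¹(ℚ_p, W[p^m])`**
  (`nsmul_continuousCohomology_one_eq_zero`).
* **`closure_minus_sup_eq_top_and_card_eq_padic`** (+ `…_cyclotomic`): file 94 with these two
  hypotheses removed — B3 in level-`m` shape for `Σ = closure{minus classes}` modulo ONLY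
  `#H¹(ℚ_p, W[p^m])[p] ≤ p²` (local duality + Euler characteristic, fact-shaped) and the Kummer group
  of `W(ℚ_p)` (order `p^m`, an element of order `p^m`, classes of points of `W(ℚ_p)`).

References: [Kobayashi2003] Thm. 6.2 (p. 11), Prop. 8.7, Prop. 8.12, Lemma 8.17;
[SerreGaloisCohomology1997] II §5.2 Prop. 14; [SilvermanAEC2009] Cor. III.6.4.
-/

noncomputable section

open scoped Classical

open WeierstrassCurve Field

namespace Summit.BirchSwinnertonDyer.Rank1Residual.Additive.SignedTwist

open Literature.NumberTheory.EllipticCurves Literature.NumberTheory.GaloisRepresentations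
  Literature.NumberTheory.EllipticCurves.Kobayashi2003 Literature.NumberTheory.EllipticCurves.ZpDescent
  Summit.BirchSwinnertonDyer.Rank1Residual.AdditivePotMult
  Summit.BirchSwinnertonDyer.Rank1Residual.Additive.PadicCyclotomicTower
  ZpExtension
open scoped ContRepresentation

/-! ## §1 The two discharges -/

/-- **`H¹(ℚ_p, W[n])` is finite** for `W/ℚ` elliptic and `n ≠ 0`: local Galois cohomology of a
finite module over the local field `ℚ_p`. [cite: SerreGaloisCohomology1997, II §5.2 Prop. 14]
[cite: SilvermanAEC2009, Cor. III.6.4] -/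
theorem finite_galoisCohomology_torsion_padic (W : WeierstrassCurve ℚ) [W.IsElliptic] {p : ℕ} [Fact p.Prime]
    {n : ℤ} (hn : n ≠ 0) :
    Finite (galoisCohomology (GaloisRep.restrictField ℚ_[p] (W.torsionGaloisModule n)) 1) := by
  haveI := Padic.isNonarchimedeanLocalField_holds p
  haveI : Finite (geomTorsion W n) := finite_torsionPoints_holds W (AlgebraicClosure ℚ) hn
  exact finite_galoisCohomology_one_of_isNonarchimedeanLocalField
    (GaloisRep.restrictField ℚ_[p] (W.torsionGaloisModule n))

/-- **`p^m` kills `H¹(E, W[p^m])`** (the coefficients are killed by `p^m`). [folklore] -/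
theorem pow_smul_galoisCohomology_torsion_eq_zero (W : WeierstrassCurve ℚ) {p : ℕ} (m : ℕ)
    (E : Type) [Field E] [Algebra ℚ E]
    (h : galoisCohomology (GaloisRep.restrictField E (W.torsionGaloisModule ((p ^ m : ℕ) : ℤ))) 1) :
    p ^ m • h = 0 :=
  nsmul_continuousCohomology_one_eq_zero _ (p ^ m)
    (fun T : geomTorsion W ((p ^ m : ℕ) : ℤ) => AddSubgroup.torsionBy.nsmul T) h

/-! ## §2 B3 in level-`m` shape modulo `#H[p] ≤ p²` and the Kummer group -/

section Generic

variable (W : WeierstrassCurve ℚ) [W.IsElliptic] (K₀ : Type) [Field K₀] [NumberField K₀] {θ : K₀} {c : ℚ}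
  (hθ : θ ∉ Set.range (algebraMap ℚ K₀)) (hc : θ ^ 2 = algebraMap ℚ K₀ c)
  {p : ℕ} [hp : Fact p.Prime] (κ : ZpExtension ℚ p)
  {V : WeierstrassCurve ℚ} [V.IsElliptic] {C : VariableChange ℚ} (hCV : C • W.quadraticTwist c = V)
  (η : absoluteGaloisGroup ℚ →* ℤˣ)
  (hη : ∀ σ : absoluteGaloisGroup ℚ, η σ = 1 ↔ σ • rootInClosure K₀ θ = rootInClosure K₀ θ)

include hθ hc hCV hη in
/-- **B3 in level-`m` shape for the signed twist, modulo `#H¹(ℚ_p, W[p^m])[p] ≤ p²` and the Kummer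
group** (generic tower hypotheses of file 91; `2m ≤ n + 1`): for `Σ = closure{minus classes}` and a
subgroup `K` of order `p^m` with an element of order `p^m` consisting of Kummer classes of points of
`W(ℚ_p)`: `Σ ⊔ K = ⊤`, `#Σ = p^m`, `#H¹(ℚ_p, W[p^m]) = p^{2m}`, and `Σ` has an element of order `p^m`.
[cite: Kobayashi2003, Thm. 6.2 (p. 11), Prop. 8.7 (p. 16), Prop. 8.12 (p. 17), Lemma 8.17 (p. 19)] -/
theorem closure_minus_sup_eq_top_and_card_eq_padic
    (hD : ∀ g : absoluteGaloisGroup ℚ, ∃ τ : absoluteGaloisGroup ℚ_[p],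
      (resGalOfEmb (closureEmb (K := ℚ) ℚ_[p]) τ)⁻¹ * g ∈ towerTopSubgroup κ K₀)
    (hκ₀ : ∀ x, ∃ g ∈ galRange (K := ℚ) K₀, κ g = x) [(galRange (K := ℚ) K₀).Normal]
    (hidx : (galRange (K := ℚ) K₀).index ≤ p - 1) (hp2 : p ≠ 2)
    (M : WeierstrassCurve ℤ_[p]) [hE : (M.map PadicInt.Coe.ringHom).IsElliptic]
    [hEt : (M.map PadicInt.toZMod).IsElliptic]
    (htr : Literature.NumberTheory.EllipticCurves.HasseManin.tr (M.map PadicInt.toZMod) = 0)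
    (hVM : M.baseChange (AlgebraicClosure ℚ_[p]) = V.baseChange (AlgebraicClosure ℚ_[p]))
    (hU : ∀ n, localSubgroupOfEmb (towerSubgroup κ K₀ n) (closureEmb (K := ℚ) ℚ_[p]) = stab p (n + 1))
    {n m : ℕ} (hnm : 2 * m ≤ n + 1)
    (hHp : Nat.card (nsmulAddMonoidHom p : galoisCohomology
        (GaloisRep.restrictField ℚ_[p] (W.torsionGaloisModule ((p ^ m : ℕ) : ℤ))) 1 →+ _).ker ≤ p ^ 2)
    (Kum : AddSubgroup (galoisCohomology
      (GaloisRep.restrictField ℚ_[p] (W.torsionGaloisModule ((p ^ m : ℕ) : ℤ))) 1))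
    (hKcard : Nat.card Kum = p ^ m) (hk₀ : ∃ k ∈ Kum, addOrderOf k = p ^ m)
    (hKum : ∀ ξ ∈ Kum, ∃ Q ∈ localLayerPointsOfEmb κ (closureEmb (K := ℚ) ℚ_[p]) W 0,
        ∃ R' : localPoints W ℚ_[p], ((p ^ m : ℕ) : ℤ) • R' = Q ∧
        ∃ φ' : contOneCocycles (DiscreteGaloisModule.toTopRep
            (GaloisRep.restrictField ℚ_[p] (W.torsionGaloisModule ((p ^ m : ℕ) : ℤ)))),
          oneCocycleClass _ φ' = ξ ∧
          ∀ u : absoluteGaloisGroup ℚ_[p],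
            pointsMap W ℚ_[p] ((φ'.1 u : geomTorsion W ((p ^ m : ℕ) : ℤ)) : geomPoints W) = u • R' - R') :
    AddSubgroup.closure {ξ | ∃ x ∈ signedLocalPointsOfEmb κ (closureEmb (K := ℚ) ℚ_[p]) W (-1) n ⊓
          (localTraceOfEmb κ (closureEmb (K := ℚ) ℚ_[p]) W 0 n).ker,
        ∃ R : localPoints W ℚ_[p], ((p ^ m : ℕ) : ℤ) • R = x ∧
        ∃ φ : contOneCocycles (DiscreteGaloisModule.toTopRep
            (GaloisRep.restrictField ℚ_[p] (W.torsionGaloisModule ((p ^ m : ℕ) : ℤ)))),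
          oneCocycleClass _ φ = ξ ∧
          ∀ u ∈ localLayerSubgroupOfEmb κ (closureEmb (K := ℚ) ℚ_[p]) n,
            pointsMap W ℚ_[p] ((φ.1 u : geomTorsion W ((p ^ m : ℕ) : ℤ)) : geomPoints W) = u • R - R} ⊔
        Kum = ⊤ ∧
      Nat.card (AddSubgroup.closure {ξ | ∃ x ∈ signedLocalPointsOfEmb κ (closureEmb (K := ℚ) ℚ_[p]) W (-1) n ⊓
          (localTraceOfEmb κ (closureEmb (K := ℚ) ℚ_[p]) W 0 n).ker,
        ∃ R : localPoints W ℚ_[p], ((p ^ m : ℕ) : ℤ) • R = x ∧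
        ∃ φ : contOneCocycles (DiscreteGaloisModule.toTopRep
            (GaloisRep.restrictField ℚ_[p] (W.torsionGaloisModule ((p ^ m : ℕ) : ℤ)))),
          oneCocycleClass _ φ = ξ ∧
          ∀ u ∈ localLayerSubgroupOfEmb κ (closureEmb (K := ℚ) ℚ_[p]) n,
            pointsMap W ℚ_[p] ((φ.1 u : geomTorsion W ((p ^ m : ℕ) : ℤ)) : geomPoints W) = u • R - R}) =
        p ^ m ∧
      Nat.card (galoisCohomology (GaloisRep.restrictField ℚ_[p] (W.torsionGaloisModule ((p ^ m : ℕ) : ℤ))) 1) =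
        p ^ (2 * m) ∧
      ∃ s ∈ AddSubgroup.closure {ξ | ∃ x ∈ signedLocalPointsOfEmb κ (closureEmb (K := ℚ) ℚ_[p]) W (-1) n ⊓
          (localTraceOfEmb κ (closureEmb (K := ℚ) ℚ_[p]) W 0 n).ker,
        ∃ R : localPoints W ℚ_[p], ((p ^ m : ℕ) : ℤ) • R = x ∧
        ∃ φ : contOneCocycles (DiscreteGaloisModule.toTopRep
            (GaloisRep.restrictField ℚ_[p] (W.torsionGaloisModule ((p ^ m : ℕ) : ℤ)))),
          oneCocycleClass _ φ = ξ ∧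
          ∀ u ∈ localLayerSubgroupOfEmb κ (closureEmb (K := ℚ) ℚ_[p]) n,
            pointsMap W ℚ_[p] ((φ.1 u : geomTorsion W ((p ^ m : ℕ) : ℤ)) : geomPoints W) = u • R - R},
        addOrderOf s = p ^ m := by
  haveI := finite_galoisCohomology_torsion_padic W (p := p) (n := ((p ^ m : ℕ) : ℤ))
    (by exact_mod_cast pow_ne_zero m hp.out.ne_zero)
  exact closure_minus_sup_eq_top_and_card_eq W K₀ hθ hc κ hCV η hη hD hκ₀ hidx hp2 M htr hVM hU hnm
    (pow_smul_galoisCohomology_torsion_eq_zero W m ℚ_[p]) hHp Kum hKcard hk₀ hKum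

end Generic

section Cyclotomic

variable (W : WeierstrassCurve ℚ) [W.IsElliptic] {p : ℕ} [hp : Fact p.Prime] (κ : ZpExtension ℚ p)
  {V : WeierstrassCurve ℚ} [V.IsElliptic]
  (F : Type) [Field F] [NumberField F] [IsCyclotomicExtension {p} ℚ F]

include F in
/-- **B3 in level-`m` shape, Kobayashi's setting, modulo `#H[p] ≤ p²` and the Kummer group**
(`F = ℚ(μ_p)`, `θ = √p*`, `κ` cyclotomic, `V = C • W^{(p*)}` with a good supersingular `a_p = 0`
model, `p` odd, `2m ≤ n + 1`). [cite: Kobayashi2003, §3 p. 5, Thm. 6.2 (p. 11), Prop. 8.7 (p. 16),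
Prop. 8.12 (p. 17), Lemma 8.17 (p. 19)] -/
theorem closure_minus_sup_eq_top_and_card_eq_padic_cyclotomic (hp2 : p ≠ 2) (hκ : κ.IsCyclotomic)
    (C : VariableChange ℚ) (hCV : C • W.quadraticTwist ((-1) ^ (p / 2) * p) = V)
    (M : WeierstrassCurve ℤ_[p]) [hE : (M.map PadicInt.Coe.ringHom).IsElliptic]
    [hEt : (M.map PadicInt.toZMod).IsElliptic]
    (htr : Literature.NumberTheory.EllipticCurves.HasseManin.tr (M.map PadicInt.toZMod) = 0)
    (hVM : M.baseChange (AlgebraicClosure ℚ_[p]) = V.baseChange (AlgebraicClosure ℚ_[p]))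
    {n m : ℕ} (hnm : 2 * m ≤ n + 1)
    (hHp : Nat.card (nsmulAddMonoidHom p : galoisCohomology
        (GaloisRep.restrictField ℚ_[p] (W.torsionGaloisModule ((p ^ m : ℕ) : ℤ))) 1 →+ _).ker ≤ p ^ 2)
    (Kum : AddSubgroup (galoisCohomology
      (GaloisRep.restrictField ℚ_[p] (W.torsionGaloisModule ((p ^ m : ℕ) : ℤ))) 1))
    (hKcard : Nat.card Kum = p ^ m) (hk₀ : ∃ k ∈ Kum, addOrderOf k = p ^ m)
    (hKum : ∀ ξ ∈ Kum, ∃ Q ∈ localLayerPointsOfEmb κ (closureEmb (K := ℚ) ℚ_[p]) W 0,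
        ∃ R' : localPoints W ℚ_[p], ((p ^ m : ℕ) : ℤ) • R' = Q ∧
        ∃ φ' : contOneCocycles (DiscreteGaloisModule.toTopRep
            (GaloisRep.restrictField ℚ_[p] (W.torsionGaloisModule ((p ^ m : ℕ) : ℤ)))),
          oneCocycleClass _ φ' = ξ ∧
          ∀ u : absoluteGaloisGroup ℚ_[p],
            pointsMap W ℚ_[p] ((φ'.1 u : geomTorsion W ((p ^ m : ℕ) : ℤ)) : geomPoints W) = u • R' - R') :
    AddSubgroup.closure {ξ | ∃ x ∈ signedLocalPointsOfEmb κ (closureEmb (K := ℚ) ℚ_[p]) W (-1) n ⊓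
          (localTraceOfEmb κ (closureEmb (K := ℚ) ℚ_[p]) W 0 n).ker,
        ∃ R : localPoints W ℚ_[p], ((p ^ m : ℕ) : ℤ) • R = x ∧
        ∃ φ : contOneCocycles (DiscreteGaloisModule.toTopRep
            (GaloisRep.restrictField ℚ_[p] (W.torsionGaloisModule ((p ^ m : ℕ) : ℤ)))),
          oneCocycleClass _ φ = ξ ∧
          ∀ u ∈ localLayerSubgroupOfEmb κ (closureEmb (K := ℚ) ℚ_[p]) n,
            pointsMap W ℚ_[p] ((φ.1 u : geomTorsion W ((p ^ m : ℕ) : ℤ)) : geomPoints W) = u • R - R} ⊔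
        Kum = ⊤ ∧
      Nat.card (AddSubgroup.closure {ξ | ∃ x ∈ signedLocalPointsOfEmb κ (closureEmb (K := ℚ) ℚ_[p]) W (-1) n ⊓
          (localTraceOfEmb κ (closureEmb (K := ℚ) ℚ_[p]) W 0 n).ker,
        ∃ R : localPoints W ℚ_[p], ((p ^ m : ℕ) : ℤ) • R = x ∧
        ∃ φ : contOneCocycles (DiscreteGaloisModule.toTopRep
            (GaloisRep.restrictField ℚ_[p] (W.torsionGaloisModule ((p ^ m : ℕ) : ℤ)))),
          oneCocycleClass _ φ = ξ ∧
          ∀ u ∈ localLayerSubgroupOfEmb κ (closureEmb (K := ℚ) ℚ_[p]) n,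
            pointsMap W ℚ_[p] ((φ.1 u : geomTorsion W ((p ^ m : ℕ) : ℤ)) : geomPoints W) = u • R - R}) =
        p ^ m ∧
      Nat.card (galoisCohomology (GaloisRep.restrictField ℚ_[p] (W.torsionGaloisModule ((p ^ m : ℕ) : ℤ))) 1) =
        p ^ (2 * m) ∧
      ∃ s ∈ AddSubgroup.closure {ξ | ∃ x ∈ signedLocalPointsOfEmb κ (closureEmb (K := ℚ) ℚ_[p]) W (-1) n ⊓
          (localTraceOfEmb κ (closureEmb (K := ℚ) ℚ_[p]) W 0 n).ker,
        ∃ R : localPoints W ℚ_[p], ((p ^ m : ℕ) : ℤ) • R = x ∧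
        ∃ φ : contOneCocycles (DiscreteGaloisModule.toTopRep
            (GaloisRep.restrictField ℚ_[p] (W.torsionGaloisModule ((p ^ m : ℕ) : ℤ)))),
          oneCocycleClass _ φ = ξ ∧
          ∀ u ∈ localLayerSubgroupOfEmb κ (closureEmb (K := ℚ) ℚ_[p]) n,
            pointsMap W ℚ_[p] ((φ.1 u : geomTorsion W ((p ^ m : ℕ) : ℤ)) : geomPoints W) = u • R - R},
        addOrderOf s = p ^ m := by
  haveI := finite_galoisCohomology_torsion_padic W (p := p) (n := ((p ^ m : ℕ) : ℤ))
    (by exact_mod_cast pow_ne_zero m hp.out.ne_zero)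
  exact closure_minus_sup_eq_top_and_card_eq_cyclotomic W κ F hp2 hκ C hCV M htr hVM hnm
    (pow_smul_galoisCohomology_torsion_eq_zero W m ℚ_[p]) hHp Kum hKcard hk₀ hKum

end Cyclotomic

end Summit.BirchSwinnertonDyer.Rank1Residual.Additive.SignedTwist

end
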